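import Summits.MatrixMultiplication.OmegaCensus.STPP211Z2pow6DirectChunks

/-!
# (2,1,1)¹⁰ ⊄ (ℤ/2)⁶ — part S2 class 10, decisions 2/4: direct search over the hard class #25 of `reps29` (roots d = 7, d = 21)

Cell `pub-omega` (unit `pub-omega-stpp-1-g37`), topic `Summits/MatrixMultiplication/OmegaCensus`.
HONEST FRAMING (verbatim): lottery ticket; floor = certified bounds/negative ranges. Census STRUCTURE bookkeeping (B5, `T1((ℤ/2)⁶)`, Pb237);
nothing here is a bound on `ω`.

Class #25 of `reps29` in the translated form `C' = hc10 = [0, 1, 2, 4, 8, 16, 31, 32, 35, 44]` (`+ 0`, block of `c = 0` first; linear stabilizer of order 48,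
root representatives [3, 5, 7, 21, 33, 37, 39, 47, 53]; HOME `pub-omega-stpp-1-g36/code/hard_perd.json`). The kernel evaluates the direct engine
(`STPP211Z2pow6DirectEngine.rootD`, soundness `noNF_of_rootD`) in CHUNKS of the root node (`STPP211Z2pow6DirectChunks.rootDX`, ≤ 10⁵ search
calls each, exact counts from the seat's C mirror `godc.c`; this file: 405,260 calls) and assembles `rootD C' d = true` per root by
`rootD_of_chunks`. The class theorem follows in `STPP211Z2pow6Hard10Class` (symmetry transport, `STPP211Z2pow6DirectTransport`).

References: H. Cohn, R. Kleinberg, B. Szegedy, C. Umans, FOCS 2005 (arXiv:math/0511460), Def. 5.1.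
-/

namespace Summit.MatrixMultiplication.OmegaCensus

namespace T1CosetEng

/-- KERNEL: root `d = 7`, chunk 1 (codes `x = 0 … 26` of the branching label's lane; 93,077 search calls). -/
theorem hc10_d7_c1 : rootDX [0, 1, 2, 4, 8, 16, 31, 32, 35, 44] 7 134217727 = true := by decide +kernel

/-- KERNEL: root `d = 7`, chunk 2 (codes `x = 27 … 63` of the branching label's lane; 74,768 search calls). -/
theorem hc10_d7_c2 : rootDX [0, 1, 2, 4, 8, 16, 31, 32, 35, 44] 7 18446744073575333888 = true := by decide +kernel

/-- KERNEL (assembled): the direct search from the root `A₀ = {0, dec 7}` refutes every normal-form family over `C'`. -/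
theorem hc10_d7 : rootD [0, 1, 2, 4, 8, 16, 31, 32, 35, 44] 7 = true :=
  rootD_of_chunks [0, 1, 2, 4, 8, 16, 31, 32, 35, 44] 7 [134217727, 18446744073575333888] (by decide) (cover_of_all64 _ (by decide)) (by
    intro M hM
    simp only [List.mem_cons, List.not_mem_nil, or_false] at hM
    rcases hM with rfl | rfl
    exacts [hc10_d7_c1, hc10_d7_c2])

/-- KERNEL: root `d = 21`, chunk 1 (codes `x = 0 … 14` of the branching label's lane; 91,216 search calls). -/
theorem hc10_d21_c1 : rootDX [0, 1, 2, 4, 8, 16, 31, 32, 35, 44] 21 32767 = true := by decide +kernel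

/-- KERNEL: root `d = 21`, chunk 2 (codes `x = 15 … 39` of the branching label's lane; 96,631 search calls). -/
theorem hc10_d21_c2 : rootDX [0, 1, 2, 4, 8, 16, 31, 32, 35, 44] 21 1099511595008 = true := by decide +kernel

/-- KERNEL: root `d = 21`, chunk 3 (codes `x = 40 … 63` of the branching label's lane; 49,566 search calls). -/
theorem hc10_d21_c3 : rootDX [0, 1, 2, 4, 8, 16, 31, 32, 35, 44] 21 18446742974197923840 = true := by decide +kernel

/-- KERNEL (assembled): the direct search from the root `A₀ = {0, dec 21}` refutes every normal-form family over `C'`. -/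
theorem hc10_d21 : rootD [0, 1, 2, 4, 8, 16, 31, 32, 35, 44] 21 = true :=
  rootD_of_chunks [0, 1, 2, 4, 8, 16, 31, 32, 35, 44] 21 [32767, 1099511595008, 18446742974197923840] (by decide) (cover_of_all64 _ (by decide)) (by
    intro M hM
    simp only [List.mem_cons, List.not_mem_nil, or_false] at hM
    rcases hM with rfl | rfl | rfl
    exacts [hc10_d21_c1, hc10_d21_c2, hc10_d21_c3])

end T1CosetEng

end Summit.MatrixMultiplication.OmegaCensus
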